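import Summits.ResolutionOfSingularities.ResolutionOfSingularities.Theorems.FrobeniusLadderFRationalResolutionFixedChartOfRoot
import HarnessLib

/-!
# Crux `FrobeniusLadder.FRationalResolution` (stmt-ResolutionOfSingularities-15317), line `redirect`,
# stub `stub_diagonalizableQuotientResolution` — item (F2c): the root-adjunction step (R₀) as a STANDALONE re-charting (no
# split-off), with the new grading group `A × ZMod d` and the new unit-degree subgroup `B̃ = {(i, m) : i − m•a ∈ B}` explicit

`…FixedChartOfRoot.exists_fixed_chart_of_rootAdjoin` chains (R) root adjunction and (S) split-off in one step and therefore needs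
`B ⊔ ⟨a⟩ = ⊤` (cyclic stabiliser `A/B`). The multi-root recipe of MEMO-15317-leafhand2-g22 (several roots, then ONE split-off
with the complement `C' × ∏ ZMod d_i`) needs the root adjunction alone, iterable, with exact bookkeeping of the group:

* `mem_unitDegrees_iff` — the unit-degree subgroup of `S̃ = S[w]/(w^d − u)` at a prime over `𝔔` is EXACTLY
  `{(i, m) ∈ A × ZMod d : i − m•a ∈ B}` (`d • a = deg u`, `u ∉ 𝔔`, `d ≥ 2`);
* ★★ `exists_rootAdjoin_chart` — chart `(A, S, 𝒮, φ)` of the stub's shape, point `v`, prime `𝔔` over `v` with unit-degree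
  subgroup `B`, `u ∈ S_b ∖ 𝔔`, `d • a = b`, `d ≥ 2`, and `hreg` (regularity of `S̃` at the primes over `v` — discharged by
  `…FixedChartOfWildDegree` for `b ∉ p·B` and by `…RootAdjoinRegularOfTameDegree` for `d ∈ k^×`) ⇒ a chart
  `(A × ZMod d, L, ℒ, φ')` of the SAME shape (`L = S̃_t` regular of finite type, `φ'` étale, compatible with the structure maps),
  a point `v'` with `φ' v' = φ v`, a prime `𝔔'` over `v'`, and the unit-degree subgroup of `𝔔'` is `{(i, m) : i − m•a ∈ B}`.

Honest label: helper toward ONE leaf stub; no stub, crux or summit closed. No definitions, no named facts, no sorry.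
[folklore; cite: SGA3, Exp. VIII §4–5] [cite: Matsumura1987, §30, Cor. to Thm. 30.5] [cite: StacksProject, Tag 07NG]
-/

noncomputable section

-- single-problem summit: the doubled namespace component is forced
set_option linter.dupNamespace false

open CategoryTheory AlgebraicGeometry Polynomial
open Literature.RingTheory.GradedAlgebra
open Literature.AlgebraicGeometry.Resolution
open Literature.AlgebraicGeometry.Resolution.DiagonalizableQuotient

namespace Summit.ResolutionOfSingularities.ResolutionOfSingularities.Theorems.FRationalResolution.RootAdjoinRechart

universe u v w

/-! ### The unit-degree subgroup of the root-adjunction chart, exactly -/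

/-- **The unit-degree subgroup of `S̃ = S[w]/(w^d − u)` at a prime over `𝔔` is `{(i, m) : i − m•a ∈ B}`** (`B` the unit-degree
subgroup of `𝔔`, `d • a = deg u`, `u ∉ 𝔔`, `d ≥ 2`). [folklore; cite: SGA3, Exp. VIII §4–5] -/
theorem mem_unitDegrees_iff {k : Type u} [CommRing k] {A : Type w} [DecidableEq A] [AddCommGroup A] {S : Type v}
    [CommRing S] [Algebra k S] (𝒮 : A → Submodule k S) [GradedAlgebra 𝒮]
    (d : ℕ) [Fact (1 < d)] (u : S) (a : A)
    (𝒯 : A × ZMod d → Submodule k (AdjoinRoot (X ^ d - C u : S[X])))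
    (h𝒯 : ∀ (p : A × ZMod d) (x : AdjoinRoot (X ^ d - C u : S[X])), x ∈ 𝒯 p ↔
      ∃ c ∈ 𝒮 (p.1 - p.2.val • a),
        x = AdjoinRoot.of (X ^ d - C u : S[X]) c * AdjoinRoot.root (X ^ d - C u : S[X]) ^ p.2.val)
    (𝔔 : Ideal S) (𝔔' : Ideal (AdjoinRoot (X ^ d - C u : S[X]))) [𝔔'.IsPrime]
    (h𝔔' : 𝔔'.comap (AdjoinRoot.of (X ^ d - C u : S[X])) = 𝔔)
    (B : AddSubgroup A) (hB : ∀ i : A, i ∈ B ↔ ∃ s ∈ 𝒮 i, s ∉ 𝔔)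
    (B' : AddSubgroup (A × ZMod d)) (hB' : ∀ p : A × ZMod d, p ∈ B' ↔ ∃ x ∈ 𝒯 p, x ∉ 𝔔') (huQ : u ∉ 𝔔)
    (p : A × ZMod d) : p ∈ B' ↔ p.1 - p.2.val • a ∈ B := by
  haveI : NeZero d := ⟨by have := (Fact.out : 1 < d); omega⟩
  refine ⟨fun hp => RootAdjoinUnits.sub_mem_of_mem_unitDegrees 𝒮 d u a 𝒯 h𝒯 𝔔 𝔔' h𝔔' B hB B' hB' hp, fun hp => ?_⟩
  have h1 : ((p.1 - p.2.val • a, (0 : ZMod d)) : A × ZMod d) + p.2.val • (a, (1 : ZMod d)) ∈ B' :=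
    add_mem (RootAdjoinUnits.mem_unitDegrees_of_mem 𝒮 d u a 𝒯 h𝒯 𝔔 𝔔' h𝔔' B hB B' hB' hp)
      (nsmul_mem (RootAdjoinUnits.root_mem_unitDegrees 𝒮 d u a 𝒯 h𝒯 𝔔 𝔔' h𝔔' B hB B' hB' huQ) _)
  have heq : ((p.1 - p.2.val • a, (0 : ZMod d)) : A × ZMod d) + p.2.val • (a, (1 : ZMod d)) = p := by
    ext
    · simp
    · simp
  rwa [heq] at h1

/-! ### The standalone root-adjunction re-charting -/

/-- ★★ **(R₀) Root adjunction as a re-charting of the same shape.** Chart `(A, S, 𝒮, φ)` (`S` of finite type, `φ` étale and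
compatible with the structure maps), point `v`, prime `𝔔` over `v` with unit-degree subgroup `B`, a homogeneous `u ∈ S_b ∖ 𝔔`,
`d • a = b` with `d ≥ 2`, and `hreg`: `S̃ = AdjoinRoot (X^d − C u)` regular at the primes over `v`. Then there is a chart
`(A × ZMod d, L, ℒ, φ')` of the same shape — `L` regular of finite type graded by `A × ZMod d`, `φ' : Spec L_0 → X` étale and
compatible with the structure maps — a point `v'` with `φ' v' = φ v`, and a prime `𝔔'` of `L` over `v'` whose unit-degree
subgroup is `{(i, m) : i − m•a ∈ B}`. (`L = S̃_t` for some `t ∈ S_0 ∖ 𝔮`.) [folklore; cite: SGA3, Exp. VIII §4–5]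
[cite: Matsumura1987, §30, Cor. to Thm. 30.5] [cite: StacksProject, Tag 07NG] -/
theorem exists_rootAdjoin_chart (k : Type) [Field k] (X : Scheme.{0}) (g : X ⟶ Spec (.of k))
    (A : Type) [AddCommGroup A] [Finite A] [DecidableEq A] (S : Type) [CommRing S] [Algebra k S]
    (𝒮 : A → Submodule k S) [GradedAlgebra 𝒮] [Algebra.FiniteType k S]
    (φ : Spec (.of (𝒮 0)) ⟶ X) [Etale φ]
    (hφg : φ ≫ g = Spec.map (CommRingCat.ofHom (algebraMap k (𝒮 0))))
    (v : Spec (.of (𝒮 0))) (𝔔 : Ideal S) [𝔔.IsPrime] (h𝔔v : 𝔔.comap (algebraMap (𝒮 0) S) = v.asIdeal)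
    (B : AddSubgroup A) (hB : ∀ i : A, i ∈ B ↔ ∃ s ∈ 𝒮 i, s ∉ 𝔔)
    (u : S) (b : A) (hu : u ∈ 𝒮 b) (huQ : u ∉ 𝔔) (a : A) (d : ℕ) (hd : 1 < d) (hab : d • a = b)
    (hreg : ∀ (𝔓 : Ideal (AdjoinRoot (Polynomial.X ^ d - Polynomial.C u : Polynomial S))) [𝔓.IsPrime],
      𝔓.comap (algebraMap (𝒮 0) (AdjoinRoot (Polynomial.X ^ d - Polynomial.C u : Polynomial S))) = v.asIdeal →
        IsRegularLocalRing (Localization.AtPrime 𝔓)) :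
    ∃ (L : Type) (_ : CommRing L) (_ : Algebra k L) (ℒ : A × ZMod d → Submodule k L) (_ : GradedAlgebra ℒ),
      Algebra.FiniteType k L ∧ IsRegularRing L ∧
      ∃ (φ' : Spec (.of (ℒ 0)) ⟶ X), Etale φ' ∧
        φ' ≫ g = Spec.map (CommRingCat.ofHom (algebraMap k (ℒ 0))) ∧
        ∃ (v' : Spec (.of (ℒ 0))) (𝔔' : Ideal L) (_ : 𝔔'.IsPrime),
          𝔔'.comap (algebraMap (ℒ 0) L) = v'.asIdeal ∧
          (∀ q : A × ZMod d, (∃ x ∈ ℒ q, x ∉ 𝔔') ↔ q.1 - q.2.val • a ∈ B) ∧ φ' v' = φ v := by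
  classical
  haveI : Fact (1 < d) := ⟨hd⟩
  haveI : NeZero d := ⟨by omega⟩
  haveI : Nontrivial S := FixedChartOfSummand.nontrivial_of_ne_top 𝔔 (inferInstance : 𝔔.IsPrime).ne_top
  have hA : AddMonoid.IsTorsion A := fun i => isOfFinAddOrder_of_finite i
  -- (R) the root-adjunction chart
  set P : Polynomial S := Polynomial.X ^ d - Polynomial.C u with hP
  obtain ⟨𝒯, inst𝒯, h𝒯⟩ := RootAdjoinChart.exists_rootGrading 𝒮 d u a b hu hab
  haveI : Algebra.FiniteType k (AdjoinRoot P) := RootAdjoinChart.finiteType (k := k) d u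
  obtain ⟨e, he⟩ := RootAdjoinChart.exists_ringEquiv_gradeZero 𝒮 d u a 𝒯 h𝒯
  -- a prime over `𝔔` and its contractions
  obtain ⟨𝔔', h𝔔'p, h𝔔'⟩ := RootAdjoinUnits.exists_prime_over d u 𝔔
  haveI := h𝔔'p
  have halg0 : ∀ x : 𝒮 0, algebraMap (𝒮 0) (AdjoinRoot P) x = AdjoinRoot.of P (x : S) := fun x => rfl
  have hcomap0 : ∀ (𝔓 : Ideal (AdjoinRoot P)), 𝔓.comap (algebraMap (𝒮 0) (AdjoinRoot P)) =
      (𝔓.comap (AdjoinRoot.of P)).comap (algebraMap (𝒮 0) S) := fun 𝔓 => by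
    ext x; simp only [Ideal.mem_comap, halg0]; rfl
  have h𝔔'v : 𝔔'.comap (algebraMap (𝒮 0) (AdjoinRoot P)) = v.asIdeal := by rw [hcomap0, h𝔔', h𝔔v]
  -- shrink: `S̃_t` regular for some `t ∈ S₀ ∖ 𝔮`
  haveI : Module.Finite S (AdjoinRoot P) := RootAdjoinChart.module_finite d u
  haveI : Algebra.IsIntegral S (AdjoinRoot P) := Algebra.IsIntegral.of_finite S _
  haveI : Algebra.IsIntegral (𝒮 0) S := DiagonalizableQuotient.algebra_isIntegral 𝒮 hA
  haveI : Algebra.IsIntegral (𝒮 0) (AdjoinRoot P) := Algebra.IsIntegral.trans S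
  haveI : v.asIdeal.IsPrime := v.isPrime
  obtain ⟨t₀, ht₀v, hregL⟩ := FixedChartOfRoot.exists_isRegularRing_away k (R₀ := 𝒮 0) (B := AdjoinRoot P) v.asIdeal
    (fun 𝔓 _ h𝔓 => hreg 𝔓 h𝔓)
  set t : AdjoinRoot P := algebraMap (𝒮 0) (AdjoinRoot P) t₀ with ht
  have ht0 : t ∈ 𝒯 0 := by rw [ht, halg0]; exact RootAdjoinChart.of_mem 𝒮 d u a 𝒯 h𝒯 t₀.2
  have htQ : t ∉ 𝔔' := fun h => ht₀v (by rw [← h𝔔'v, Ideal.mem_comap]; exact h)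
  have hT : ∀ s ∈ Submonoid.powers t, s ∈ 𝒯 0 := AwayUnits.powers_subset_gradeZero 𝒯 ht0
  let L : Type := Localization.Away t
  haveI : IsRegularRing L := hregL
  let ℒ : (A × ZMod d) → Submodule k L := locPiece 𝒯 (Submonoid.powers t) hT L
  letI instℒ : GradedAlgebra ℒ := (nonempty_gradedAlgebra_locPiece 𝒯 _ hT L).some
  haveI hftL : Algebra.FiniteType k L := by
    show Algebra.FiniteType k (Localization (Submonoid.powers t))
    infer_instance
  -- the prime of `L` and the unit-degree subgroup
  have hdisj : Disjoint ((Submonoid.powers t : Submonoid (AdjoinRoot P)) : Set (AdjoinRoot P)) (𝔔' : Set (AdjoinRoot P)) := by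
    rw [Set.disjoint_left]
    rintro _ ⟨n, rfl⟩ h
    exact htQ (h𝔔'p.mem_of_pow_mem n h)
  set 𝔔L : Ideal L := 𝔔'.map (algebraMap (AdjoinRoot P) L) with h𝔔L
  haveI h𝔔Lp : 𝔔L.IsPrime := IsLocalization.isPrime_of_isPrime_disjoint (Submonoid.powers t) L 𝔔' h𝔔'p hdisj
  have hcomapL : 𝔔L.comap (algebraMap (AdjoinRoot P) L) = 𝔔' :=
    IsLocalization.under_map_of_isPrime_disjoint (Submonoid.powers t) L h𝔔'p hdisj
  have hÃ : AddMonoid.IsTorsion (A × ZMod d) := fun p => isOfFinAddOrder_of_finite p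
  obtain ⟨B', hB'L, -⟩ := StabilizerSubgroup.exists_unitDegrees_addSubgroup ℒ hÃ 𝔔L
  have hB' : ∀ p : A × ZMod d, p ∈ B' ↔ ∃ x ∈ 𝒯 p, x ∉ 𝔔' := fun p =>
    (hB'L p).trans (FixedChartOfRoot.unitDegrees_away_iff 𝒯 hT L 𝔔' htQ p)
  have hB'iff : ∀ q : A × ZMod d, (∃ x ∈ ℒ q, x ∉ 𝔔L) ↔ q.1 - q.2.val • a ∈ B := fun q =>
    (hB'L q).symm.trans (mem_unitDegrees_iff 𝒮 d u a 𝒯 h𝒯 𝔔 𝔔' h𝔔' B hB B' hB' huQ q)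
  -- the chart map `Spec (L_0) → Spec (S̃_0) ≅ Spec S₀ → X`
  let j : 𝒯 0 →+* ℒ 0 := locPieceZeroHom 𝒯 (Submonoid.powers t) hT L
  have hjval : ∀ y, (j y : L) = algebraMap (AdjoinRoot P) L y := fun y => rfl
  have hjet : j.Etale := FixedChart.etale_locPieceZeroHom 𝒯 ht0 hT L
  haveI : Etale (Spec.map (CommRingCat.ofHom j)) := (HasRingHomProperty.Spec_iff (P := @Etale)).mpr hjet
  haveI : IsIso (CommRingCat.ofHom (R := 𝒮 0) (S := 𝒯 0) e.toRingHom) := by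
    show IsIso (RingEquiv.toCommRingCatIso (R := 𝒮 0) (S := 𝒯 0) e).hom
    infer_instance
  let φL : Spec (.of (ℒ 0)) ⟶ X :=
    Spec.map (CommRingCat.ofHom j) ≫ Spec.map (CommRingCat.ofHom (R := 𝒮 0) (S := 𝒯 0) e.toRingHom) ≫ φ
  haveI hφLet : Etale φL := inferInstance
  have hφLg : φL ≫ g = Spec.map (CommRingCat.ofHom (algebraMap k (ℒ 0))) := by
    simp only [φL, Category.assoc, hφg, ← Spec.map_comp]
    congr 1
    refine CommRingCat.hom_ext (RingHom.ext fun c => ?_)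
    apply Subtype.ext
    simp only [CommRingCat.hom_comp, CommRingCat.hom_ofHom, RingHom.coe_comp, Function.comp_apply]
    show ((j (e (algebraMap k (𝒮 0) c))) : L) = ((algebraMap k (ℒ 0) c) : L)
    rw [hjval, he, SetLike.GradeZero.coe_algebraMap, SetLike.GradeZero.coe_algebraMap, ← AdjoinRoot.algebraMap_eq,
      ← IsScalarTower.algebraMap_apply, ← IsScalarTower.algebraMap_apply]
  -- the point of `Spec (L_0)` under `𝔔L` maps to `v`
  let vL : Spec (.of (ℒ 0)) := ⟨𝔔L.comap (algebraMap (ℒ 0) L), Ideal.IsPrime.comap _⟩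
  have hvL : φL vL = φ v := by
    show φ (Spec.map (CommRingCat.ofHom (R := 𝒮 0) (S := 𝒯 0) e.toRingHom) (Spec.map (CommRingCat.ofHom j) vL)) = φ v
    congr 1
    apply PrimeSpectrum.ext
    rw [Spec.map_apply, PrimeSpectrum.comap_asIdeal, Spec.map_apply, PrimeSpectrum.comap_asIdeal]
    show ((𝔔L.comap (algebraMap (ℒ 0) L)).comap j).comap e.toRingHom = v.asIdeal
    have h1 : (𝔔L.comap (algebraMap (ℒ 0) L)).comap j = 𝔔'.comap (algebraMap (𝒯 0) (AdjoinRoot P)) := by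
      rw [Ideal.comap_comap, ← hcomapL, Ideal.comap_comap]
      exact congrArg (fun f => Ideal.comap f 𝔔L) (RingHom.ext fun _ => rfl)
    rw [h1, RootAdjoinUnits.comap_comap_ringEquiv 𝒮 d u a 𝒯 h𝒯 𝔔' e he, h𝔔', h𝔔v]
  exact ⟨L, inferInstance, inferInstance, ℒ, instℒ, hftL, hregL, φL, hφLet, hφLg, vL, 𝔔L, h𝔔Lp, rfl, hB'iff, hvL⟩

end Summit.ResolutionOfSingularities.ResolutionOfSingularities.Theorems.FRationalResolution.RootAdjoinRechart

end
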